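import Summits.ResolutionOfSingularities.ResolutionOfSingularities.Theorems.MarkedTransferCampaignW46MohWindowShade
import Literature.AlgebraicGeometry.Resolution.PointBlowupKangaroo
import HarnessLib

/-!
# [OURS · L1 W4.6] Rung (iii) "Moh window" for the classical pair — the DECREASE LAWS inside the window:
  at the points of the chart `y_j` the shade drops by at least the `y_j`-order of the initial form of
  the residual factor (all dimensions)

Cell `res-hironaka`, rung L, slot W4.6, seat `res-L1-s46-pv-6` (gen 2).  Gen 0
(`MarkedTransferCampaignW46MohWindowShade.lean`) is the NO-INCREASE half of the role of Th. 16.6 (2) /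
Eq. (127) for the classical pair (lane-B reading note, desk #35); `…NoInvariant.lean` shows that for
ARBITRARY point centres no strictly decreasing invariant exists.  This file is the positive, quantitative
DECREASE half that does hold, in the tree's transcription of [Hauser2010, §§F–G]
(`PointBlowup.State/step/shade`, `PointBlowupShade.lean`): for a state `(F, r)` with `y^r ∣ F` and order
`o` strictly inside the window, `p < o < 2p`, write `F = y^r G`, `a = o − |r|` = shade, and let `G_a` be
the initial form of `G` (the monomials `y^d` of `F` with `|d| = o`, divided by `y^r`).  Then at the blow-up
of the origin, read in the chart `y_j` (every field of characteristic `p`, every number of variables):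

* `shade_step_add_le_of_forall` — AT EVERY POINT `b` of the chart (`b_j = 0`):
  `shade' + m_j ≤ shade`, where `m_j = ord_{y_j} G_a` is the least `y_j`-exponent of the initial monomials
  of `G` (hypothesis: `r_j + m ≤ d_j` on the initial monomials of `F`).  So if `y_j` divides the initial
  form of the residual factor, the shade DROPS at every point of the chart `y_j`
  (`shadeDrops_of_forall_lt`), and a stall anywhere in the chart forces an initial monomial of `G` free of
  `y_j` (`exists_initial_apply_eq_of_not_shadeDrops`).
* `shade_step_add_le_origin` — AT THE ORIGIN of the chart (the monomial move): `shade' + M_j ≤ shade`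
  for `M_j = deg_{y_j} G_a`, the LARGEST `y_j`-exponent of an initial monomial of `G`; a stall at the
  origin of the chart `y_j` forces the whole initial form `G_a` to be free of `y_j`
  (`forall_initial_apply_eq_of_not_shadeDrops_origin`) — the window analogue of "the order of the strict
  transform drops unless the tangent cone is degenerate".
Mechanism (Moh's "possibility (II)", tree `PointBlowup.exists_mem_support_translate_layer` /
`exists_support_step_of_not_dvd`, sharpened by the `y_j`-order of `G_a`): the image `y^E` of an initial
monomial in the lowest `y_j`-layer of the chart transform has `E_j = o − p`, which lies strictly between
`0` and `p` INSIDE THE WINDOW, so it is not a `p`-th power and survives the cleaning; its degree is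
`(o − p) + (o − d_j)`.  OURS; replaces — for regime (iii) of RESCUE-SEED W4.6 and the classical pair — the
ROLE of the strict-inequality clause of Th. 16.6 (2) / Eq. (127) (ms. p. 84 l. 10–20) where the model has
one; NOT a statement of the manuscript [claim: Hironaka2017, status: under-review], nothing of which is
used.  AI review is weaker than expert review.
-/

noncomputable section

set_option linter.dupNamespace false -- mandated namespace of this single-conjunct summit

open MvPolynomial Finset

open scoped BigOperators

namespace Summit.ResolutionOfSingularities.ResolutionOfSingularities.Theorems.CampaignW46.MohWindowShadeDecrease

open Literature.AlgebraicGeometry.Resolution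
open Literature.AlgebraicGeometry.Resolution.PointBlowup
open Literature.AlgebraicGeometry.Resolution.Hauser2010
open Literature.Barriers.ResolutionOfSingularities (ordZero_le_of_coeff_ne_zero le_ordZero_of_forall)

variable {σ : Type*} {K : Type*} [Field K] [Fintype σ] [DecidableEq σ] [DecidableEq K]
variable (p : ℕ) [hp : Fact p.Prime] [CharP K p]

omit [DecidableEq K] hp [CharP K p] in
/-- An initial monomial bounds its own `y_j`-excess by the shade: `d_j − r_j ≤ o − |r|` for `y^d` of
degree `o` with `r ≤ d`. [folklore] -/
theorem apply_sub_le_shade (s : State σ K) {o : ℕ} (j : σ) {d : σ →₀ ℕ} (hrd : s.r ≤ d)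
    (hdeg : d.degree = o) : d j - s.r j ≤ o - s.r.degree := by
  classical
  have h1 := degree_eq_add_sum_erase j d
  have h2 := degree_eq_add_sum_erase j s.r
  have h3 : ∑ i ∈ univ.erase j, s.r i ≤ ∑ i ∈ univ.erase j, d i :=
    Finset.sum_le_sum fun i _ => Finsupp.le_def.mp hrd i
  omega


omit [Fintype σ] [DecidableEq σ] [DecidableEq K] hp [CharP K p] in
/-- `x + 1 ≤ y < ⊤` in `ℕ∞` gives `x < y`. [folklore] -/
theorem enat_lt_of_add_one_le {x y : ℕ∞} (hy : y ≠ ⊤) (h : x + 1 ≤ y) : x < y := by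
  lift y to ℕ using hy
  have hx : x ≠ ⊤ := by
    rintro rfl
    exact absurd h (by simp)
  lift x to ℕ using hx
  have h' : x + 1 ≤ y := by exact_mod_cast h
  exact_mod_cast (Nat.lt_of_succ_le h')

omit hp [CharP K p] in
/-- **[OURS · L1 W4.6] THE DECREASE LAW AT EVERY POINT OF THE CHART `y_j`.**  Let `(F, r)` be a state with
`y^r ∣ F` and order `o`, `p < o < 2p`, and suppose every initial monomial `y^d` of `F` (`|d| = o`) has
`d_j ≥ r_j + m` — i.e. `y_j^m` divides the initial form of the residual factor `G = F / y^r`.  Then at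
EVERY point `b` of the chart `y_j` (`b_j = 0`) of the blow-up of the origin the shade drops by at least
`m`:  `shade(step) + m ≤ shade`.  NOT a statement of the manuscript. [folklore] -/
theorem shade_step_add_le_of_forall (j : σ) (b : σ → K) (hbj : b j = 0) (s : State σ K) {o : ℕ}
    (ho : ordZero s.F = o) (hlo : p < o) (hhi : o < 2 * p) (hr : ∀ d ∈ s.F.support, s.r ≤ d)
    {m : ℕ} (hm : ∀ d ∈ s.F.support, d.degree = o → s.r j + m ≤ d j) :
    (step p j b s).shade + m ≤ s.shade := by
  classical
  obtain ⟨⟨d₀, hd₀, hd₀deg⟩, -⟩ := (ordZero_eq_nat_iff _ _).mp ho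
  have hdeg := le_degree_of_ordZero_eq s ho
  have hd₀s : d₀ ∈ s.F.support := MvPolynomial.mem_support_iff.mpr hd₀
  have hpo : p ≤ o := hlo.le
  -- `m ≤ a = o − |r|`
  have hma : m ≤ o - s.r.degree := by
    have h1 := apply_sub_le_shade s j (hr d₀ hd₀s) hd₀deg
    have h2 := hm d₀ hd₀s hd₀deg
    omega
  have hrdeg : s.r.degree ≤ o := hd₀deg ▸ degree_le_degree_of_le (hr d₀ hd₀s)
  -- the layer `E_j = o − p` of the chart transform
  set ρ : σ →₀ ℕ := s.r.update j (o - p) with hρdef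
  have hρj : ρ j = o - p := by rw [hρdef, Finsupp.update_apply, if_pos rfl]
  have hρi : ∀ i, i ≠ j → ρ i = s.r i := fun i hi => by
    rw [hρdef, Finsupp.update_apply, if_neg hi]
  have hsupp : ∀ e ∈ (chartTransform p j s.F).support,
      ∃ d ∈ s.F.support, chartExponent p j d = e := by
    intro e he
    unfold chartTransform at he
    obtain ⟨d, hd, -, hde⟩ := exists_of_mem_support_sum_monomial _ _ _ he
    exact ⟨d, hd, hde⟩
  have hρle : ∀ e ∈ (chartTransform p j s.F).support, ρ ≤ e := by
    intro e he
    obtain ⟨d, hd, rfl⟩ := hsupp e he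
    rw [Finsupp.le_def]
    intro i
    rw [chartExponent_apply]
    by_cases hij : i = j
    · subst hij
      rw [if_pos rfl, hρj]
      have := hdeg d hd
      omega
    · rw [if_neg hij, hρi i hij]
      exact Finsupp.le_def.mp (hr d hd) i
  -- the sharpened layer bound: `|e| ≤ |ρ| + (a − m)` on the layer
  have hD : ∀ e ∈ (chartTransform p j s.F).support, e j = ρ j →
      e.degree ≤ ρ.degree + (o - s.r.degree - m) := by
    intro e he hej
    obtain ⟨d, hd, rfl⟩ := hsupp e he
    rw [chartExponent_apply, if_pos rfl, hρj] at hej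
    have h1 := hdeg d hd
    have h2 : d.degree = o := by omega
    rw [degree_chartExponent, h2]
    have h3 := degree_update_add s.r j (o - p)
    rw [← hρdef] at h3
    have h4 : s.r j + m ≤ d j := hm d hd h2
    have h5 : d j ≤ o := h2 ▸ Finsupp.le_degree j d
    have h6 : s.r j ≤ s.r.degree := Finsupp.le_degree j s.r
    omega
  have hlayer : ∃ e ∈ (chartTransform p j s.F).support, e j = ρ j := by
    refine ⟨chartExponent p j d₀, ?_, ?_⟩
    · rw [MvPolynomial.mem_support_iff]
      unfold chartTransform
      rw [coeff_sum_monomial_of_injOn s.F.support (chartExponent p j) (fun d => coeff d s.F) hd₀s]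
      · exact hd₀
      · intro d hd _ h
        exact chartExponent_injective (le_trans hpo (hdeg d hd)) (le_trans hpo (hdeg d₀ hd₀s)) h
    · rw [chartExponent_apply, if_pos rfl, hd₀deg, hρj]
  obtain ⟨E, hE, hEj, hEdeg⟩ :=
    exists_mem_support_translate_layer b hbj (chartTransform p j s.F) ρ hρle (o - s.r.degree - m)
      hD hlayer
  -- inside the window `E_j = o − p` is not divisible by `p`: `y^E` survives the cleaning
  have hEj' : E j = o - p := by rw [hEj, hρj]
  have hnot : ¬ IsPthPowerExponent p E := by
    intro h
    have h1 : p ∣ E j := (isPthPowerExponent_iff p E).mp h j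
    rw [hEj'] at h1
    have h2 : 0 < o - p := by omega
    have := Nat.le_of_dvd h2 h1
    omega
  have hEstep : E ∈ (step p j b s).F.support := by
    show E ∈ (deletePthPowers p (pointTransform p j b s)).support
    rw [MvPolynomial.mem_support_iff, coeff_deletePthPowers, if_neg hnot]
    exact MvPolynomial.mem_support_iff.mp hE
  have hr1 : (step p j b s).r = ρ.filter (fun i => b i = 0) := by
    show newMult p j b s = _
    rw [newMult_eq p j b hbj s ho, hρdef]
  have hshade' : (step p j b s).shade ≤ ((o - s.r.degree - m : ℕ) : ℕ∞) :=
    shade_le_of_mem_support _ hEstep (by rw [hr1]; exact hEdeg)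
  rw [shade_eq_of_ordZero_eq s ho]
  calc (step p j b s).shade + (m : ℕ∞)
      ≤ ((o - s.r.degree - m : ℕ) : ℕ∞) + (m : ℕ∞) := add_le_add hshade' le_rfl
    _ = ((o - s.r.degree : ℕ) : ℕ∞) := by
        rw [← Nat.cast_add]; exact_mod_cast (by omega : o - s.r.degree - m + m = o - s.r.degree)

omit hp [CharP K p] in
/-- **[OURS · L1 W4.6] Corollary: a positive `y_j`-order of the initial form makes the shade DROP at every
point of the chart `y_j`** (inside the window).  NOT a statement of the manuscript. [folklore] -/
theorem shadeDrops_of_forall_lt (j : σ) (b : σ → K) (hbj : b j = 0) (s : State σ K) {o : ℕ}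
    (ho : ordZero s.F = o) (hlo : p < o) (hhi : o < 2 * p) (hr : ∀ d ∈ s.F.support, s.r ≤ d)
    (hm : ∀ d ∈ s.F.support, d.degree = o → s.r j < d j) : ShadeDrops p j b s := by
  have h := shade_step_add_le_of_forall p j b hbj s ho hlo hhi hr (m := 1)
    (fun d hd hdo => hm d hd hdo)
  have hfin : s.shade ≠ ⊤ := by
    rw [shade_eq_of_ordZero_eq s ho]; exact ENat.coe_ne_top _
  exact enat_lt_of_add_one_le hfin (by exact_mod_cast h)

omit hp [CharP K p] in
/-- **[OURS · L1 W4.6] Corollary: a stall (or any non-drop) at a point of the chart `y_j` forces an initial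
monomial of `F` whose `y_j`-exponent is exactly `r_j`** — an initial monomial of the residual factor free
of `y_j`.  NOT a statement of the manuscript. [folklore] -/
theorem exists_initial_apply_eq_of_not_shadeDrops (j : σ) (b : σ → K) (hbj : b j = 0)
    (s : State σ K) {o : ℕ} (ho : ordZero s.F = o) (hlo : p < o) (hhi : o < 2 * p)
    (hr : ∀ d ∈ s.F.support, s.r ≤ d) (hstall : ¬ ShadeDrops p j b s) :
    ∃ d ∈ s.F.support, d.degree = o ∧ d j = s.r j := by
  by_contra hne
  push Not at hne
  apply hstall
  refine shadeDrops_of_forall_lt p j b hbj s ho hlo hhi hr fun d hd hdo => ?_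
  have h1 : s.r j ≤ d j := Finsupp.le_def.mp (hr d hd) j
  exact lt_of_le_of_ne h1 (Ne.symm (hne d hd hdo))

omit hp [CharP K p] in
/-- **[OURS · L1 W4.6] THE DECREASE LAW AT THE ORIGIN OF THE CHART `y_j` (the monomial move).**  With
`(F, r)`, `o`, `p < o < 2p` as above, if SOME initial monomial `y^{d₀}` of `F` has `d₀_j ≥ r_j + M`, then
at the origin of the chart `y_j` the shade drops by at least `M`:  `shade(step) + M ≤ shade`.  (No
translation: the image `y^E` of `y^{d₀}` itself survives, of degree `(o − p) + (o − d₀_j)`.)  Hence the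
drop at the origin is at least the `y_j`-DEGREE of the initial form of the residual factor.  NOT a
statement of the manuscript. [folklore] -/
theorem shade_step_add_le_origin (j : σ) (b : σ → K) (hb0 : ∀ i, b i = 0) (s : State σ K) {o : ℕ}
    (ho : ordZero s.F = o) (hlo : p < o) (hhi : o < 2 * p) (hr : ∀ d ∈ s.F.support, s.r ≤ d)
    {M : ℕ} {d₀ : σ →₀ ℕ} (hd₀ : d₀ ∈ s.F.support) (hd₀deg : d₀.degree = o)
    (hM : s.r j + M ≤ d₀ j) : (step p j b s).shade + M ≤ s.shade := by
  classical
  have hdeg := le_degree_of_ordZero_eq s ho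
  have hpo : p ≤ o := hlo.le
  have hMa : M ≤ o - s.r.degree := by
    have h1 := apply_sub_le_shade s j (hr d₀ hd₀) hd₀deg
    omega
  have hrdeg : s.r.degree ≤ o := hd₀deg ▸ degree_le_degree_of_le (hr d₀ hd₀)
  -- no translation at the origin
  have hb : b = 0 := funext hb0
  have hpt : pointTransform p j b s = chartTransform p j s.F := by
    unfold pointTransform; rw [hb, translate_zero]
  -- the image of `y^{d₀}`
  set E : σ →₀ ℕ := chartExponent p j d₀ with hEdef
  have hcoeff : coeff E (chartTransform p j s.F) = coeff d₀ s.F := by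
    unfold chartTransform
    rw [hEdef, coeff_sum_monomial_of_injOn s.F.support (chartExponent p j) (fun d => coeff d s.F) hd₀]
    intro d hd _ h
    exact chartExponent_injective (le_trans hpo (hdeg d hd)) (le_trans hpo (hdeg d₀ hd₀)) h
  have hEj : E j = o - p := by rw [hEdef, chartExponent_apply, if_pos rfl, hd₀deg]
  have hnot : ¬ IsPthPowerExponent p E := by
    intro h
    have h1 : p ∣ E j := (isPthPowerExponent_iff p E).mp h j
    rw [hEj] at h1
    have h2 : 0 < o - p := by omega
    have := Nat.le_of_dvd h2 h1
    omega
  have hEstep : E ∈ (step p j b s).F.support := by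
    show E ∈ (deletePthPowers p (pointTransform p j b s)).support
    rw [MvPolynomial.mem_support_iff, coeff_deletePthPowers, if_neg hnot, hpt, hcoeff]
    exact MvPolynomial.mem_support_iff.mp hd₀
  -- degrees
  have hEdeg : E.degree = (o - p) + (o - d₀ j) := by
    rw [hEdef, degree_chartExponent, hd₀deg]
  have hr1 : (step p j b s).r = s.r.update j (o - p) := by
    show newMult p j b s = _
    rw [newMult_eq p j b (hb0 j) s ho]
    ext i
    rw [Finsupp.filter_apply, if_pos (hb0 i)]
  have hr1deg : (step p j b s).r.degree + s.r j = s.r.degree + (o - p) := by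
    rw [hr1]; exact degree_update_add s.r j (o - p)
  have h5 : d₀ j ≤ o := hd₀deg ▸ Finsupp.le_degree j d₀
  have h6 : s.r j ≤ s.r.degree := Finsupp.le_degree j s.r
  have hshade' : (step p j b s).shade ≤ ((o - s.r.degree - M : ℕ) : ℕ∞) :=
    shade_le_of_mem_support _ hEstep (by omega)
  rw [shade_eq_of_ordZero_eq s ho]
  calc (step p j b s).shade + (M : ℕ∞)
      ≤ ((o - s.r.degree - M : ℕ) : ℕ∞) + (M : ℕ∞) := add_le_add hshade' le_rfl
    _ = ((o - s.r.degree : ℕ) : ℕ∞) := by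
        rw [← Nat.cast_add]; exact_mod_cast (by omega : o - s.r.degree - M + M = o - s.r.degree)

omit hp [CharP K p] in
/-- **[OURS · L1 W4.6] Corollary: a stall at the ORIGIN of the chart `y_j` forces EVERY initial monomial of
`F` to have `y_j`-exponent exactly `r_j`** — the initial form of the residual factor is free of `y_j`.
NOT a statement of the manuscript. [folklore] -/
theorem forall_initial_apply_eq_of_not_shadeDrops_origin (j : σ) (b : σ → K) (hb0 : ∀ i, b i = 0)
    (s : State σ K) {o : ℕ} (ho : ordZero s.F = o) (hlo : p < o) (hhi : o < 2 * p)
    (hr : ∀ d ∈ s.F.support, s.r ≤ d) (hstall : ¬ ShadeDrops p j b s) :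
    ∀ d ∈ s.F.support, d.degree = o → d j = s.r j := by
  intro d hd hdo
  have h1 : s.r j ≤ d j := Finsupp.le_def.mp (hr d hd) j
  by_contra hne
  have hM : s.r j + 1 ≤ d j := by omega
  have h := shade_step_add_le_origin p j b hb0 s ho hlo hhi hr hd hdo hM
  have hfin : s.shade ≠ ⊤ := by
    rw [shade_eq_of_ordZero_eq s ho]; exact ENat.coe_ne_top _
  exact hstall (enat_lt_of_add_one_le hfin (by exact_mod_cast h))


/-! ## v2 (gen 2, APPEND-ONLY): surfaces — what a stall pins down -/

omit hp [CharP K p] in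
/-- **[OURS · L1 W4.6] Surfaces: a stall at the ORIGIN of the chart `y_j` pins the initial form of the
residual factor to `c · y_i^a`.**  For two residual variables `σ = {j, i}`, inside the window, if the shade
does not drop at the origin of the chart `y_j`, then every initial monomial `y^d` of `F` (`|d| = o`) is THE
monomial `d = r + a·e_i` (`d_j = r_j`, `d_i = r_i + a`, `a = o − |r|`): the initial form of `G = F/y^r` is a
constant times `y_i^a`.  NOT a statement of the manuscript. [folklore] -/
theorem initial_eq_of_not_shadeDrops_origin_two_vars {j i : σ} (hij : i ≠ j)
    (htwo : ∀ l, l = j ∨ l = i) (b : σ → K) (hb0 : ∀ l, b l = 0) (s : State σ K) {o : ℕ}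
    (ho : ordZero s.F = o) (hlo : p < o) (hhi : o < 2 * p) (hr : ∀ d ∈ s.F.support, s.r ≤ d)
    (hstall : ¬ ShadeDrops p j b s) :
    ∀ d ∈ s.F.support, d.degree = o → d j = s.r j ∧ d i + s.r.degree = s.r i + o := by
  classical
  intro d hd hdo
  have hj := forall_initial_apply_eq_of_not_shadeDrops_origin p j b hb0 s ho hlo hhi hr hstall d hd hdo
  refine ⟨hj, ?_⟩
  have herase : (Finset.univ : Finset σ).erase j = {i} := by
    ext l
    rw [Finset.mem_erase, Finset.mem_singleton]
    constructor
    · rintro ⟨hlj, -⟩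
      rcases htwo l with h | h
      · exact absurd h hlj
      · exact h
    · intro h; rw [h]; exact ⟨hij, Finset.mem_univ i⟩
  have h1 := degree_eq_add_sum_erase j d
  have h2 := degree_eq_add_sum_erase j s.r
  rw [herase, Finset.sum_singleton] at h1 h2
  omega

omit hp [CharP K p] in
/-- **[OURS · L1 W4.6] Surfaces: a stall ANYWHERE in the chart `y_j` forces the monomial `y^r · y_i^a`
among the initial monomials of `F`** (the initial form of the residual factor contains `y_i^a` with a
non-zero coefficient).  NOT a statement of the manuscript. [folklore] -/
theorem exists_initial_eq_of_not_shadeDrops_two_vars {j i : σ} (hij : i ≠ j)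
    (htwo : ∀ l, l = j ∨ l = i) (b : σ → K) (hbj : b j = 0) (s : State σ K) {o : ℕ}
    (ho : ordZero s.F = o) (hlo : p < o) (hhi : o < 2 * p) (hr : ∀ d ∈ s.F.support, s.r ≤ d)
    (hstall : ¬ ShadeDrops p j b s) :
    ∃ d ∈ s.F.support, d.degree = o ∧ d j = s.r j ∧ d i + s.r.degree = s.r i + o := by
  classical
  obtain ⟨d, hd, hdo, hj⟩ :=
    exists_initial_apply_eq_of_not_shadeDrops p j b hbj s ho hlo hhi hr hstall
  refine ⟨d, hd, hdo, hj, ?_⟩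
  have herase : (Finset.univ : Finset σ).erase j = {i} := by
    ext l
    rw [Finset.mem_erase, Finset.mem_singleton]
    constructor
    · rintro ⟨hlj, -⟩
      rcases htwo l with h | h
      · exact absurd h hlj
      · exact h
    · intro h; rw [h]; exact ⟨hij, Finset.mem_univ i⟩
  have h1 := degree_eq_add_sum_erase j d
  have h2 := degree_eq_add_sum_erase j s.r
  rw [herase, Finset.sum_singleton] at h1 h2
  omega

end Summit.ResolutionOfSingularities.ResolutionOfSingularities.Theorems.CampaignW46.MohWindowShadeDecrease
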